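import Literature.Analysis.FunctionSpaces.AgmonExteriorCone
import HarnessLib

/-!
# Agmon's inequality under a cone condition with decay imposed only near infinity

(namespace `Literature.Analysis.FunctionSpaces`)

`AgmonExteriorCone.lean` proves the homogeneous three-dimensional Agmon inequality
`μ(B_{1/2}) Φ(x)² ≤ (18/θ) ∫_U ‖DΦ‖² + (81θ/2) ∫_U ‖D²Φ‖²` (and its optimised form
`Φ(x)² ≤ (54/μ(B_{1/2})) ‖DΦ‖₂ ‖D²Φ‖₂`) for `Φ ∈ C²(U)` on an open set `U` of a three-dimensional
space containing the cone `{x + s z : s > 0, ‖z − n‖ < ½}`, under the a priori decay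
`‖y‖|Φ(y)| ≤ C₀`, `‖y‖‖DΦ(y)‖ ≤ C₀` **at every point of `U`**. In the proof (radial integration from
infinity along the rays `s ↦ x + s z`, `sq_le_lintegral_ray`) the decay is used only to kill the
boundary term at the far end of each ray, i.e. only at points `x + s z` with `s` large, where
`‖x + s z‖ ≥ s/4` is large. This file records the correspondingly sharper statements, with the
decay hypothesis imposed only on `U ∩ {‖y‖ ≥ R}` for some radius `R`:

* `mul_sq_le_lintegral_of_cone_of_far` — the additive form;
* `sq_le_sqrt_mul_sqrt_of_cone_of_far` — the multiplicative form.

In particular no boundedness of `Φ` or `DΦ` near the finite part of `∂U` is required (for a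
function that is unbounded near `∂U` the right-hand sides are infinite on a domain with a uniform
cone condition, but the point is that the user need not *verify* boundedness there), and for a
function vanishing outside a bounded set the decay hypothesis is vacuous (`C₀ = 0`). This is the
form needed to localise the inequality with a cut-off `χ Φ` on the Kerr–Schild slices, where `Φ`
is a derivative of a wave known to be smooth on the open exterior region only
(`Literature/Geometry/Lorentzian/KerrDerivativeDecayEnergy.lean`). The proofs are those of
`AgmonExteriorCone.lean` verbatim except for the choice of the threshold `s₀` along the rays
(`s₀ = 4(‖x‖ + 1) + 4 max(R, 0)`). Agmon (1965) §13; Foias–Manley–Rosa–Temam (2001), Ch. II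
(A.29); Moschidis, arXiv:1509.08489, Lemma 9.10 (`d = 3`). Everything is proved; no named facts.

## References

* S. Agmon, *Lectures on elliptic boundary value problems*, Van Nostrand (1965), §13, Lemma 13.2.
* C. Foias, O. Manley, R. Rosa, R. Temam, *Navier–Stokes equations and turbulence*, CUP (2001),
  Ch. II, App. A, (A.29) (key `FoiasManleyRosaTemam2001`).
* G. Moschidis, *The `r^p`-weighted energy method of Dafermos and Rodnianski in general
  asymptotically flat spacetimes and applications*, Ann. PDE 2 (2016), arXiv:1509.08489, Lemma 9.10
  (key `Moschidis2016`).
-/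

noncomputable section

open MeasureTheory Set Filter Metric Module
open scoped ENNReal Topology

namespace Literature.Analysis.FunctionSpaces

section AgmonFar

variable {E : Type*} [NormedAddCommGroup E] [NormedSpace ℝ E] [MeasurableSpace E] [BorelSpace E]
  [FiniteDimensional ℝ E] (μ : Measure E) [μ.IsAddHaarMeasure]

/-- **Agmon's inequality on a three-dimensional domain with a cone condition, additive form, with
decay imposed only near infinity.** Let `U` be open in a three-dimensional real normed space,
`x ∈ U`, `n` a unit vector such that the cone `{x + s z : s > 0, ‖z − n‖ < ½}` lies in `U`, and
`Φ ∈ C²(U)` with `‖y‖ |Φ(y)| ≤ C₀`, `‖y‖ ‖DΦ(y)‖ ≤ C₀` at the points `y ∈ U` with `‖y‖ ≥ R`. Then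
for every `θ > 0`
`μ(B(0, ½)) Φ(x)² ≤ (18/θ) ∫_U ‖DΦ‖² dμ + (81θ/2) ∫_U ‖D²Φ‖² dμ`
(ray inequality `sq_le_lintegral_ray` along `s ↦ x + s z`, where `|f'| ≤ (3/2)‖DΦ‖`,
`|f''| ≤ (9/4)‖D²Φ‖` and, for `s ≥ 4(‖x‖ + 1) + 4 max(R, 0)`, `‖x + s z‖ ≥ s/4 ≥ R`; averaged over
`z ∈ B(n, ½)` with `lintegral_ball_lintegral_ray_le`). Agmon (1965) §13; Foias–Manley–Rosa–Temam
(2001) Ch. II (A.29); Moschidis arXiv:1509.08489 Lemma 9.10 (`d = 3`); the all-of-`U` decay version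
is `mul_sq_le_lintegral_of_cone`. [cite: FoiasManleyRosaTemam2001, Ch. II (A.29)] -/
theorem mul_sq_le_lintegral_of_cone_of_far (hE : finrank ℝ E = 3) {U : Set E} (hU : IsOpen U)
    {x n : E} (hx : x ∈ U) (hn : ‖n‖ = 1)
    (hcone : ∀ z ∈ ball n (1 / 2 : ℝ), ∀ s : ℝ, 0 < s → x + s • z ∈ U)
    {Φ : E → ℝ} (hΦ : ContDiffOn ℝ 2 Φ U) {C₀ R : ℝ}
    (hdec : ∀ y ∈ U, R ≤ ‖y‖ → ‖y‖ * |Φ y| ≤ C₀ ∧ ‖y‖ * ‖fderiv ℝ Φ y‖ ≤ C₀) {θ : ℝ}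
    (hθ : 0 < θ) :
    μ (ball (0 : E) (1 / 2)) * ENNReal.ofReal (Φ x ^ 2) ≤
      ENNReal.ofReal (18 / θ) * (∫⁻ y in U, ENNReal.ofReal (‖fderiv ℝ Φ y‖ ^ 2) ∂μ) +
        ENNReal.ofReal (81 * θ / 2) *
          ∫⁻ y in U, ENNReal.ofReal (‖fderiv ℝ (fderiv ℝ Φ) y‖ ^ 2) ∂μ := by
  -- the two densities, extended by zero off `U`
  set G₁ : E → ℝ≥0∞ := U.indicator fun y ↦ ENNReal.ofReal (‖fderiv ℝ Φ y‖ ^ 2) with hG₁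
  set G₂ : E → ℝ≥0∞ := U.indicator fun y ↦ ENNReal.ofReal (‖fderiv ℝ (fderiv ℝ Φ) y‖ ^ 2)
    with hG₂
  have hG₁m : Measurable G₁ :=
    (ENNReal.measurable_ofReal.comp ((measurable_fderiv ℝ Φ).norm.pow_const 2)).indicator
      hU.measurableSet
  have hG₂m : Measurable G₂ :=
    (ENNReal.measurable_ofReal.comp
      ((measurable_fderiv ℝ (fderiv ℝ Φ)).norm.pow_const 2)).indicator hU.measurableSet
  have hI₁ : ∫⁻ y, G₁ y ∂μ = ∫⁻ y in U, ENNReal.ofReal (‖fderiv ℝ Φ y‖ ^ 2) ∂μ :=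
    lintegral_indicator hU.measurableSet _
  have hI₂ : ∫⁻ y, G₂ y ∂μ = ∫⁻ y in U, ENNReal.ofReal (‖fderiv ℝ (fderiv ℝ Φ) y‖ ^ 2) ∂μ :=
    lintegral_indicator hU.measurableSet _
  -- a nonnegative decay constant
  set C₁ : ℝ := max C₀ 0 with hC₁def
  have hC₁ : 0 ≤ C₁ := le_max_right _ _
  have hdec₁ : ∀ y ∈ U, R ≤ ‖y‖ → ‖y‖ * |Φ y| ≤ C₁ ∧ ‖y‖ * ‖fderiv ℝ Φ y‖ ≤ C₁ := fun y hy hR ↦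
    ⟨(hdec y hy hR).1.trans (le_max_left _ _), (hdec y hy hR).2.trans (le_max_left _ _)⟩
  -- the threshold along the rays
  set s₀ : ℝ := 4 * (‖x‖ + 1) + 4 * max R 0 with hs₀def
  have hR0 : 0 ≤ max R 0 := le_max_right _ _
  have hs₀pos : 0 < s₀ := by rw [hs₀def]; nlinarith [norm_nonneg x]
  -- Step A: the ray inequality for each direction `z` in the ball
  have hray : ∀ z ∈ ball n (1 / 2 : ℝ), ENNReal.ofReal (Φ x ^ 2) ≤
      ENNReal.ofReal (9 / θ) * (∫⁻ s in Ioi (0 : ℝ), ENNReal.ofReal (s ^ 2) * G₁ (x + s • z)) +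
        ENNReal.ofReal (81 * θ / 4) *
          ∫⁻ s in Ioi (0 : ℝ), ENNReal.ofReal (s ^ 2) * G₂ (x + s • z) := by
    intro z hz
    have hzn : ‖z - n‖ < 1 / 2 := by rwa [mem_ball, dist_eq_norm] at hz
    have hz1 : ‖z‖ ≤ 3 / 2 := by
      calc ‖z‖ = ‖(z - n) + n‖ := by rw [sub_add_cancel]
        _ ≤ ‖z - n‖ + ‖n‖ := norm_add_le _ _
        _ ≤ 3 / 2 := by rw [hn]; linarith
    have hz2 : 1 / 2 ≤ ‖z‖ := by
      have : ‖n‖ ≤ ‖z‖ + ‖z - n‖ := by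
        calc ‖n‖ = ‖z - (z - n)‖ := by rw [sub_sub_cancel]
          _ ≤ ‖z‖ + ‖z - n‖ := norm_sub_le _ _
      rw [hn] at this
      linarith
    -- the ray `s ↦ x + s z` stays in `U` for `s ≥ 0`
    have hγU : ∀ s : ℝ, 0 ≤ s → x + s • z ∈ U := by
      intro s hs
      rcases hs.eq_or_lt with h | h
      · rw [← h]
        simpa using hx
      · exact hcone z hz s h
    have hγd : ∀ s : ℝ, HasDerivAt (fun t : ℝ ↦ x + t • z) z s := fun s ↦ by
      simpa using ((hasDerivAt_id' s).smul_const z).const_add x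
    have hC2 : ∀ s : ℝ, 0 ≤ s → ContDiffAt ℝ 2 Φ (x + s • z) := fun s hs ↦
      hΦ.contDiffAt (hU.mem_nhds (hγU s hs))
    have hD1 : ∀ s : ℝ, 0 ≤ s → ContDiffAt ℝ 1 (fderiv ℝ Φ) (x + s • z) := fun s hs ↦
      (hC2 s hs).fderiv_right (by norm_num)
    -- the functions `f, f', f''` along the ray
    set f : ℝ → ℝ := fun s ↦ Φ (x + s • z) with hf
    set f' : ℝ → ℝ := fun s ↦ fderiv ℝ Φ (x + s • z) z with hf'
    set f'' : ℝ → ℝ := fun s ↦ fderiv ℝ (fderiv ℝ Φ) (x + s • z) z z with hf''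
    have hfd : ∀ s, 0 ≤ s → HasDerivAt f (f' s) s := fun s hs ↦
      ((hC2 s hs).differentiableAt (by norm_num)).hasFDerivAt.comp_hasDerivAt s (hγd s)
    have hf'd : ∀ s, 0 ≤ s → HasDerivAt f' (f'' s) s := by
      intro s hs
      have h1 : HasDerivAt (fun t : ℝ ↦ fderiv ℝ Φ (x + t • z))
          (fderiv ℝ (fderiv ℝ Φ) (x + s • z) z) s :=
        ((hD1 s hs).differentiableAt (by norm_num)).hasFDerivAt.comp_hasDerivAt s (hγd s)
      have h2 := h1.clm_apply (hasDerivAt_const s z)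
      simpa [hf', hf''] using h2
    have hf''c : ContinuousOn f'' (Ici 0) := by
      intro s hs
      have hc : ContinuousAt (fun t : ℝ ↦ fderiv ℝ (fderiv ℝ Φ) (x + t • z)) s :=
        ContinuousAt.comp (f := fun t : ℝ ↦ x + t • z)
          ((hD1 s hs).continuousAt_fderiv one_ne_zero) (hγd s).continuousAt
      exact ((hc.clm_apply continuousAt_const).clm_apply continuousAt_const).continuousWithinAt
    -- decay along the ray: for `s ≥ s₀`, `‖x + s z‖ ≥ s/4 ≥ R`
    have hdec' : ∀ s, s₀ ≤ s → |f s| ≤ 6 * C₁ / s ∧ |f' s| ≤ 6 * C₁ / s := by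
      intro s hs
      have hs4 : 4 * (‖x‖ + 1) ≤ s := by rw [hs₀def] at hs; linarith
      have hs0 : 0 < s := by linarith [norm_nonneg x]
      have hsz : ‖s • z‖ = s * ‖z‖ := by rw [norm_smul, Real.norm_of_nonneg hs0.le]
      have hγn : s / 4 ≤ ‖x + s • z‖ := by
        have h1 : ‖s • z‖ ≤ ‖x + s • z‖ + ‖x‖ := by
          calc ‖s • z‖ = ‖(x + s • z) - x‖ := by rw [add_sub_cancel_left]
            _ ≤ ‖x + s • z‖ + ‖x‖ := norm_sub_le _ _
        nlinarith
      have hγpos : 0 < ‖x + s • z‖ := by linarith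
      have hγR : R ≤ ‖x + s • z‖ := by
        have h1 : R ≤ max R 0 := le_max_left _ _
        rw [hs₀def] at hs
        linarith [norm_nonneg x]
      obtain ⟨hd1, hd2⟩ := hdec₁ (x + s • z) (hγU s hs0.le) hγR
      have hΦle : |Φ (x + s • z)| ≤ C₁ / ‖x + s • z‖ := by
        rw [le_div_iff₀ hγpos, mul_comm]
        exact hd1
      have hDle : ‖fderiv ℝ Φ (x + s • z)‖ ≤ C₁ / ‖x + s • z‖ := by
        rw [le_div_iff₀ hγpos, mul_comm]
        exact hd2
      have hinv : C₁ / ‖x + s • z‖ ≤ 4 * C₁ / s := by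
        rw [div_le_div_iff₀ hγpos hs0]
        nlinarith
      have h46 : 4 * C₁ / s ≤ 6 * C₁ / s := by
        gcongr
        linarith
      refine ⟨(hΦle.trans hinv).trans h46, ?_⟩
      calc |f' s| = ‖fderiv ℝ Φ (x + s • z) z‖ := (Real.norm_eq_abs _).symm
        _ ≤ ‖fderiv ℝ Φ (x + s • z)‖ * ‖z‖ := ContinuousLinearMap.le_opNorm _ _
        _ ≤ (4 * C₁ / s) * (3 / 2) :=
            mul_le_mul (hDle.trans hinv) hz1 (norm_nonneg _) (by positivity)
        _ = 6 * C₁ / s := by ring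
    -- the one-dimensional inequality
    have h1D := sq_le_lintegral_ray hfd hf'd hf''c hs₀pos hdec' hθ
    -- compare the ray densities with `G₁, G₂`
    have hJ1 : (∫⁻ s in Ioi (0 : ℝ), ENNReal.ofReal (s ^ 2 * f' s ^ 2)) ≤
        ENNReal.ofReal (9 / 4) * ∫⁻ s in Ioi (0 : ℝ), ENNReal.ofReal (s ^ 2) * G₁ (x + s • z) := by
      rw [← lintegral_const_mul' _ _ ENNReal.ofReal_ne_top]
      refine setLIntegral_mono' measurableSet_Ioi fun s hs ↦ ?_
      have hsU : x + s • z ∈ U := hγU s (le_of_lt hs)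
      have hG : G₁ (x + s • z) = ENNReal.ofReal (‖fderiv ℝ Φ (x + s • z)‖ ^ 2) := by
        rw [hG₁, indicator_of_mem hsU]
      rw [hG, ← ENNReal.ofReal_mul (sq_nonneg _),
        ← ENNReal.ofReal_mul (p := (9 / 4 : ℝ)) (by norm_num)]
      apply ENNReal.ofReal_le_ofReal
      have hb : |f' s| ≤ ‖fderiv ℝ Φ (x + s • z)‖ * (3 / 2) := by
        calc |f' s| = ‖fderiv ℝ Φ (x + s • z) z‖ := (Real.norm_eq_abs _).symm
          _ ≤ ‖fderiv ℝ Φ (x + s • z)‖ * ‖z‖ := ContinuousLinearMap.le_opNorm _ _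
          _ ≤ ‖fderiv ℝ Φ (x + s • z)‖ * (3 / 2) := by gcongr
      have hsq : f' s ^ 2 ≤ (‖fderiv ℝ Φ (x + s • z)‖ * (3 / 2)) ^ 2 := by
        rw [← sq_abs (f' s)]
        exact pow_le_pow_left₀ (abs_nonneg _) hb 2
      have hs2 : 0 ≤ s ^ 2 := sq_nonneg s
      nlinarith [mul_le_mul_of_nonneg_left hsq hs2]
    have hJ2 : (∫⁻ s in Ioi (0 : ℝ), ENNReal.ofReal (s ^ 2 * f'' s ^ 2)) ≤
        ENNReal.ofReal (81 / 16) *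
          ∫⁻ s in Ioi (0 : ℝ), ENNReal.ofReal (s ^ 2) * G₂ (x + s • z) := by
      rw [← lintegral_const_mul' _ _ ENNReal.ofReal_ne_top]
      refine setLIntegral_mono' measurableSet_Ioi fun s hs ↦ ?_
      have hsU : x + s • z ∈ U := hγU s (le_of_lt hs)
      have hG : G₂ (x + s • z) = ENNReal.ofReal (‖fderiv ℝ (fderiv ℝ Φ) (x + s • z)‖ ^ 2) := by
        rw [hG₂, indicator_of_mem hsU]
      rw [hG, ← ENNReal.ofReal_mul (sq_nonneg _),
        ← ENNReal.ofReal_mul (p := (81 / 16 : ℝ)) (by norm_num)]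
      apply ENNReal.ofReal_le_ofReal
      have hb : |f'' s| ≤ ‖fderiv ℝ (fderiv ℝ Φ) (x + s • z)‖ * (3 / 2) * (3 / 2) := by
        calc |f'' s| = ‖fderiv ℝ (fderiv ℝ Φ) (x + s • z) z z‖ := (Real.norm_eq_abs _).symm
          _ ≤ ‖fderiv ℝ (fderiv ℝ Φ) (x + s • z) z‖ * ‖z‖ := ContinuousLinearMap.le_opNorm _ _
          _ ≤ ‖fderiv ℝ (fderiv ℝ Φ) (x + s • z)‖ * ‖z‖ * ‖z‖ := by
              gcongr
              exact ContinuousLinearMap.le_opNorm _ _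
          _ ≤ ‖fderiv ℝ (fderiv ℝ Φ) (x + s • z)‖ * (3 / 2) * (3 / 2) := by gcongr
      have hsq : f'' s ^ 2 ≤ (‖fderiv ℝ (fderiv ℝ Φ) (x + s • z)‖ * (3 / 2) * (3 / 2)) ^ 2 := by
        rw [← sq_abs (f'' s)]
        exact pow_le_pow_left₀ (abs_nonneg _) hb 2
      have hs2 : 0 ≤ s ^ 2 := sq_nonneg s
      nlinarith [mul_le_mul_of_nonneg_left hsq hs2]
    have hf0 : f 0 = Φ x := by simp [hf]
    calc ENNReal.ofReal (Φ x ^ 2) = ENNReal.ofReal (f 0 ^ 2) := by rw [hf0]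
      _ ≤ _ := h1D
      _ ≤ ENNReal.ofReal (4 / θ) * (ENNReal.ofReal (9 / 4) *
            ∫⁻ s in Ioi (0 : ℝ), ENNReal.ofReal (s ^ 2) * G₁ (x + s • z)) +
          ENNReal.ofReal (4 * θ) * (ENNReal.ofReal (81 / 16) *
            ∫⁻ s in Ioi (0 : ℝ), ENNReal.ofReal (s ^ 2) * G₂ (x + s • z)) := by
          gcongr
      _ = _ := by
          rw [← mul_assoc, ← mul_assoc, ← ENNReal.ofReal_mul (by positivity),
            ← ENNReal.ofReal_mul (by positivity),
            show 4 / θ * (9 / 4) = 9 / θ by ring,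
            show 4 * θ * (81 / 16) = 81 * θ / 4 by ring]
  -- Step B: average over the ball of directions
  have hmeasJ : ∀ {G : E → ℝ≥0∞}, Measurable G →
      Measurable fun z ↦ ∫⁻ s in Ioi (0 : ℝ), ENNReal.ofReal (s ^ 2) * G (x + s • z) := by
    intro G hG
    have hm : Measurable (fun p : E × ℝ ↦ ENNReal.ofReal (p.2 ^ 2) * G (x + p.2 • p.1)) :=
      (ENNReal.measurable_ofReal.comp (by fun_prop)).mul
        (hG.comp (show Continuous (fun p : E × ℝ ↦ x + p.2 • p.1) by fun_prop).measurable)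
    exact hm.lintegral_prod_right'
  have hball : μ (ball n (1 / 2 : ℝ)) = μ (ball (0 : E) (1 / 2)) := Measure.addHaar_ball_center μ n _
  calc μ (ball (0 : E) (1 / 2)) * ENNReal.ofReal (Φ x ^ 2)
      = ∫⁻ _ in ball n (1 / 2 : ℝ), ENNReal.ofReal (Φ x ^ 2) ∂μ := by
        rw [setLIntegral_const, hball, mul_comm]
    _ ≤ ∫⁻ z in ball n (1 / 2 : ℝ), (ENNReal.ofReal (9 / θ) *
          (∫⁻ s in Ioi (0 : ℝ), ENNReal.ofReal (s ^ 2) * G₁ (x + s • z)) +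
          ENNReal.ofReal (81 * θ / 4) *
            ∫⁻ s in Ioi (0 : ℝ), ENNReal.ofReal (s ^ 2) * G₂ (x + s • z)) ∂μ :=
        setLIntegral_mono' measurableSet_ball hray
    _ = ENNReal.ofReal (9 / θ) * (∫⁻ z in ball n (1 / 2 : ℝ),
            ∫⁻ s in Ioi (0 : ℝ), ENNReal.ofReal (s ^ 2) * G₁ (x + s • z) ∂volume ∂μ) +
          ENNReal.ofReal (81 * θ / 4) * ∫⁻ z in ball n (1 / 2 : ℝ),
            ∫⁻ s in Ioi (0 : ℝ), ENNReal.ofReal (s ^ 2) * G₂ (x + s • z) ∂volume ∂μ := by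
        rw [lintegral_add_left ((hmeasJ hG₁m).const_mul _), lintegral_const_mul _ (hmeasJ hG₁m),
          lintegral_const_mul _ (hmeasJ hG₂m)]
    _ ≤ ENNReal.ofReal (9 / θ) * (2 * ∫⁻ y, G₁ y ∂μ) +
          ENNReal.ofReal (81 * θ / 4) * (2 * ∫⁻ y, G₂ y ∂μ) := by
        gcongr
        · exact lintegral_ball_lintegral_ray_le μ hE x n hn hG₁m
        · exact lintegral_ball_lintegral_ray_le μ hE x n hn hG₂m
    _ = _ := by
        rw [hI₁, hI₂, ← mul_assoc, ← mul_assoc, ← ENNReal.ofReal_ofNat 2,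
          ← ENNReal.ofReal_mul (by positivity), ← ENNReal.ofReal_mul (by positivity),
          show 9 / θ * (2 : ℝ) = 18 / θ by ring, show 81 * θ / 4 * (2 : ℝ) = 81 * θ / 2 by ring]

/-- **Agmon's inequality on a three-dimensional domain with a cone condition, decay imposed only
near infinity.** Under the hypotheses of `mul_sq_le_lintegral_of_cone_of_far`, if
`I₁ = ∫_U ‖DΦ‖² dμ` and `I₂ = ∫_U ‖D²Φ‖² dμ` are finite then
`Φ(x)² ≤ (54 / μ(B(0, ½))) √I₁ √I₂`
— the homogeneous three-dimensional Agmon inequality (Agmon (1965) §13; Foias–Manley–Rosa–Temam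
(2001) Ch. II (A.29); Moschidis arXiv:1509.08489 Lemma 9.10, `d = 3`) on an unbounded domain with a
cone condition, for functions whose decay `‖y‖|Φ| ≤ C₀`, `‖y‖‖DΦ‖ ≤ C₀` is known only on
`U ∩ {‖y‖ ≥ R}`; the all-of-`U` version is `sq_le_sqrt_mul_sqrt_of_cone`. [cite: FoiasManleyRosaTemam2001, Ch. II (A.29)] -/
theorem sq_le_sqrt_mul_sqrt_of_cone_of_far (hE : finrank ℝ E = 3) {U : Set E} (hU : IsOpen U)
    {x n : E} (hx : x ∈ U) (hn : ‖n‖ = 1)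
    (hcone : ∀ z ∈ ball n (1 / 2 : ℝ), ∀ s : ℝ, 0 < s → x + s • z ∈ U)
    {Φ : E → ℝ} (hΦ : ContDiffOn ℝ 2 Φ U) {C₀ R : ℝ}
    (hdec : ∀ y ∈ U, R ≤ ‖y‖ → ‖y‖ * |Φ y| ≤ C₀ ∧ ‖y‖ * ‖fderiv ℝ Φ y‖ ≤ C₀)
    (h₁ : ∫⁻ y in U, ENNReal.ofReal (‖fderiv ℝ Φ y‖ ^ 2) ∂μ < ⊤)
    (h₂ : ∫⁻ y in U, ENNReal.ofReal (‖fderiv ℝ (fderiv ℝ Φ) y‖ ^ 2) ∂μ < ⊤) :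
    Φ x ^ 2 ≤ 54 / (μ (ball (0 : E) (1 / 2))).toReal *
      (Real.sqrt (∫⁻ y in U, ENNReal.ofReal (‖fderiv ℝ Φ y‖ ^ 2) ∂μ).toReal *
        Real.sqrt (∫⁻ y in U, ENNReal.ofReal (‖fderiv ℝ (fderiv ℝ Φ) y‖ ^ 2) ∂μ).toReal) := by
  set V : ℝ≥0∞ := μ (ball (0 : E) (1 / 2)) with hV
  set I₁ : ℝ≥0∞ := ∫⁻ y in U, ENNReal.ofReal (‖fderiv ℝ Φ y‖ ^ 2) ∂μ with hI₁
  set I₂ : ℝ≥0∞ := ∫⁻ y in U, ENNReal.ofReal (‖fderiv ℝ (fderiv ℝ Φ) y‖ ^ 2) ∂μ with hI₂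
  have hV0 : 0 < V := (isOpen_ball.measure_pos μ (nonempty_ball.2 (by norm_num)))
  have hVt : V < ⊤ := measure_ball_lt_top
  have hv : 0 < V.toReal := ENNReal.toReal_pos hV0.ne' hVt.ne
  -- the additive form, in real numbers
  have hadd : ∀ θ : ℝ, 0 < θ →
      V.toReal * Φ x ^ 2 ≤ 18 * I₁.toReal / θ + θ * (81 * I₂.toReal / 2) := by
    intro θ hθ
    have h := mul_sq_le_lintegral_of_cone_of_far μ hE hU hx hn hcone hΦ hdec hθ
    have hfin : ENNReal.ofReal (18 / θ) * I₁ + ENNReal.ofReal (81 * θ / 2) * I₂ ≠ ⊤ :=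
      ENNReal.add_ne_top.2 ⟨ENNReal.mul_ne_top ENNReal.ofReal_ne_top h₁.ne,
        ENNReal.mul_ne_top ENNReal.ofReal_ne_top h₂.ne⟩
    have h' := ENNReal.toReal_mono hfin h
    rw [ENNReal.toReal_mul, ENNReal.toReal_ofReal (sq_nonneg _), ENNReal.toReal_add
      (ENNReal.mul_ne_top ENNReal.ofReal_ne_top h₁.ne)
      (ENNReal.mul_ne_top ENNReal.ofReal_ne_top h₂.ne), ENNReal.toReal_mul, ENNReal.toReal_mul,
      ENNReal.toReal_ofReal (by positivity), ENNReal.toReal_ofReal (by positivity)] at h'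
    calc V.toReal * Φ x ^ 2 ≤ 18 / θ * I₁.toReal + 81 * θ / 2 * I₂.toReal := h'
      _ = 18 * I₁.toReal / θ + θ * (81 * I₂.toReal / 2) := by ring
  have hopt := le_two_mul_sqrt_mul_sqrt_of_forall (by positivity) (by positivity) hadd
  have h27 : Real.sqrt (18 * I₁.toReal) * Real.sqrt (81 * I₂.toReal / 2) =
      27 * (Real.sqrt I₁.toReal * Real.sqrt I₂.toReal) := by
    rw [Real.sqrt_mul (by norm_num), show 81 * I₂.toReal / 2 = (81 / 2) * I₂.toReal by ring,
      Real.sqrt_mul (by norm_num)]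
    have h : Real.sqrt 18 * Real.sqrt (81 / 2) = 27 := by
      rw [← Real.sqrt_mul (by norm_num), show (18 : ℝ) * (81 / 2) = 27 ^ 2 by norm_num,
        Real.sqrt_sq (by norm_num)]
    calc Real.sqrt 18 * Real.sqrt I₁.toReal * (Real.sqrt (81 / 2) * Real.sqrt I₂.toReal)
        = (Real.sqrt 18 * Real.sqrt (81 / 2)) * (Real.sqrt I₁.toReal * Real.sqrt I₂.toReal) := by
          ring
      _ = _ := by rw [h]
  rw [h27] at hopt
  rw [div_mul_eq_mul_div, le_div_iff₀ hv]
  linarith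

/-- **Agmon's inequality for functions vanishing near infinity.** Under the cone condition, if
`Φ ∈ C²(U)` vanishes at the points of `U` with `‖y‖ > R` (e.g. a cut-off `χ Φ`), then
`Φ(x)² ≤ (54 / μ(B(0, ½))) √I₁ √I₂` whenever `I₁ = ∫_U ‖DΦ‖²`, `I₂ = ∫_U ‖D²Φ‖²` are finite — no a
priori bound on `Φ` is needed anywhere (`sq_le_sqrt_mul_sqrt_of_cone_of_far` with `C₀ = 0` beyond
the radius `R + 1`, where `Φ` vanishes identically near each point, so that also `DΦ = 0`). [folklore] -/
theorem sq_le_sqrt_mul_sqrt_of_cone_of_eq_zero (hE : finrank ℝ E = 3) {U : Set E} (hU : IsOpen U)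
    {x n : E} (hx : x ∈ U) (hn : ‖n‖ = 1)
    (hcone : ∀ z ∈ ball n (1 / 2 : ℝ), ∀ s : ℝ, 0 < s → x + s • z ∈ U)
    {Φ : E → ℝ} (hΦ : ContDiffOn ℝ 2 Φ U) {R : ℝ}
    (hzero : ∀ y ∈ U, R < ‖y‖ → Φ y = 0)
    (h₁ : ∫⁻ y in U, ENNReal.ofReal (‖fderiv ℝ Φ y‖ ^ 2) ∂μ < ⊤)
    (h₂ : ∫⁻ y in U, ENNReal.ofReal (‖fderiv ℝ (fderiv ℝ Φ) y‖ ^ 2) ∂μ < ⊤) :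
    Φ x ^ 2 ≤ 54 / (μ (ball (0 : E) (1 / 2))).toReal *
      (Real.sqrt (∫⁻ y in U, ENNReal.ofReal (‖fderiv ℝ Φ y‖ ^ 2) ∂μ).toReal *
        Real.sqrt (∫⁻ y in U, ENNReal.ofReal (‖fderiv ℝ (fderiv ℝ Φ) y‖ ^ 2) ∂μ).toReal) := by
  refine sq_le_sqrt_mul_sqrt_of_cone_of_far μ hE hU hx hn hcone hΦ (C₀ := 0) (R := R + 1)
    (fun y hy hyR ↦ ?_) h₁ h₂
  have hyR' : R < ‖y‖ := by linarith
  -- `Φ` vanishes identically near `y`, hence so does its differential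
  have hev : Φ =ᶠ[𝓝 y] fun _ ↦ (0 : ℝ) := by
    have hopen : IsOpen (U ∩ {w : E | R < ‖w‖}) :=
      hU.inter (isOpen_lt continuous_const continuous_norm)
    filter_upwards [hopen.mem_nhds ⟨hy, hyR'⟩] with w hw
    exact hzero w hw.1 hw.2
  have hD : fderiv ℝ Φ y = 0 := by
    rw [hev.fderiv_eq]
    exact (hasFDerivAt_const (𝕜 := ℝ) (0 : ℝ) y).fderiv
  rw [hzero y hy hyR', hD, abs_zero, norm_zero, mul_zero]
  exact ⟨le_rfl, le_rfl⟩

end AgmonFar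

end Literature.Analysis.FunctionSpaces

end
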